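import Summits.CriticalPhenomena.PercolationContinuityZ3.Theorems.PercNearOneGluingNoHeavyLowerTailSahiGridPatternShadowTPPTwisted
import Summits.CriticalPhenomena.PercolationContinuityZ3.Theorems.PercNearOneGluingNoHeavyLowerTailSahiGridPatternCanalysing

/-!
# `NoHeavyLowerTail` (crux stmt-CriticalPhenomena-4575), Sahi programme: **twisted three-partition positivity with one HITTING or one CONTAINING family,
# every ground set and every twist** (transport of the co-orthant and orthant slots of the pattern inequality through the twisted shadow)

Support file (seat `prim-sahi-p1`, generation 10; `--supports stmt-CriticalPhenomena-4575`).  Pure proofs, no definitions, no `sorry`, standard axioms.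
Vocabulary: `…SahiGridPatternShadowTPPTwisted` (`sStarD_twistedShadow_eq`, `isUpperSet_twistedShadow`), `…SahiGridPattern{Orthant,CoOrthant}`
(`sStarD_principal_nonneg`, `sStarD_coprincipal_nonneg`), `…ThreePartitionADTwisted` (`threePartNT`).

THE MATHEMATICS.  The twisted shadow `A^τ_𝒰 = {x ∈ [3]^d : U_τ(x) ∈ 𝒰}`, `U_τ(x) = {a ∉ τ : x_a = 2} ∪ {a ∈ τ : x_a ≠ 0}`, of the HITTING family
`𝒰 = {S : S ∩ G ≠ ∅}` is the CO-ORTHANT `{x : ∃ a, q_a < x_a}` with `q_a = 1` (`a ∈ G ∖ τ`), `0` (`a ∈ G ∩ τ`), `2` (`a ∉ G`); that of the CONTAINING (principal)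
family `𝒰 = {S : G ⊆ S}` is the ORTHANT `{x : p ≤ x}` with `p_a = 2` (`a ∈ G ∖ τ`), `1` (`a ∈ G ∩ τ`), `0` (`a ∉ G`).  By the co-orthant and orthant slot
theorems (every `d`) and the twisted shadow identity `sStarD A^τ_𝒰 A^τ_𝒱 A^τ_𝒲 = 2^d·threePartNT τ 𝒰 𝒱 𝒲`:
* **`threePartNT_nonneg_of_hitting`**: `threePartNT τ {S : ∃ a ∈ G, a ∈ S} 𝒱 𝒲 ≥ 0` for every `τ`, `G`, and all up-set families `𝒱, 𝒲` on `Fin d`;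
* **`threePartNT_nonneg_of_containing`**: `threePartNT τ {S : ∀ a ∈ G, a ∈ S} 𝒱 𝒲 ≥ 0` likewise (the principal stratum, every twist; cf. the cone files
  `…ThreePartitionPrincipal`, `…ThreePartitionTwistedCone`).
In comb language: the three-copy fibre coefficient `combCoef3 U V W j ≥ 0` at every profile whenever one event's section is an OR (`∃ a ∈ G, x_a = 1`) or an AND of
coordinates.  HONEST LABEL: strata only; (★★), `PatternPos d` (`d ≥ 4`), Sahi's `C₃` and Kahn's conjecture remain OPEN. [this work]
-/

noncomputable section

open Finset
open scoped Classical symmDiff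

namespace Summit.CriticalPhenomena.PercolationContinuityZ3.Theorems.SahiGridPattern

open Summit.CriticalPhenomena.PercolationContinuityZ3.Theorems.ThreePartition

variable {d : ℕ}

/-- **Twisted three-partition positivity with one HITTING family** (`{S : S ∩ G ≠ ∅}`), every twist, every ground set `Fin d`. [this work] -/
theorem threePartNT_nonneg_of_hitting (τ : Set (Fin d)) (G : Finset (Fin d)) {𝒱 𝒲 : Set (Set (Fin d))} (h𝒱 : IsUpperSet 𝒱) (h𝒲 : IsUpperSet 𝒲) :
    0 ≤ threePartNT τ {S : Set (Fin d) | ∃ a ∈ G, a ∈ S} 𝒱 𝒲 := by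
  -- the twisted shadow of the hitting family is a co-orthant
  let q : Pd d := fun a => if a ∈ G then (if a ∈ τ then 0 else 1) else 2
  have hq : ∀ x : Pd d, (∃ a, q a < x a) ↔ {a : Fin d | (a ∉ τ ∧ x a = 2) ∨ (a ∈ τ ∧ x a ≠ 0)} ∈ {S : Set (Fin d) | ∃ a ∈ G, a ∈ S} := by
    intro x
    simp only [Set.mem_setOf_eq, q]
    constructor
    · rintro ⟨a, ha⟩
      by_cases hG : a ∈ G
      · refine ⟨a, hG, ?_⟩
        by_cases hτ : a ∈ τ
        · simp only [hG, hτ, if_true] at ha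
          exact Or.inr ⟨hτ, fun h0 => by rw [h0] at ha; exact lt_irrefl _ ha⟩
        · simp only [hG, hτ, if_true, if_false] at ha
          refine Or.inl ⟨hτ, ?_⟩
          have h2 : x a ≤ 2 := Fin.le_last _
          have : (1 : Fin 3) < x a := ha
          revert this h2; generalize x a = u; intro h1 h2; fin_cases u <;> simp_all
      · simp only [hG, if_false] at ha
        exact absurd (Fin.le_last (x a) : x a ≤ 2) (not_le.2 ha)
    · rintro ⟨a, hG, h⟩
      refine ⟨a, ?_⟩
      rcases h with ⟨hτ, h2⟩ | ⟨hτ, h0⟩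
      · simp only [hG, hτ, if_true, if_false, h2]; decide
      · simp only [hG, hτ, if_true]
        have : x a ≠ 0 := h0
        revert this; generalize x a = u; intro h; fin_cases u <;> simp_all
  have h := sStarD_coprincipal_nonneg d q _ _ (isUpperSet_twistedShadow τ h𝒱) (isUpperSet_twistedShadow τ h𝒲)
  rw [sStarD_twistedShadow_eq τ {S : Set (Fin d) | ∃ a ∈ G, a ∈ S} 𝒱 𝒲 (fun x => by rw [Finset.mem_filter]; simp only [Finset.mem_univ, true_and]; exact hq x)
    (fun x => by simp) (fun x => by simp)] at h
  exact nonneg_of_mul_nonneg_right (by rwa [mul_comm] at h) (by positivity)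

/-- **Twisted three-partition positivity with one CONTAINING (principal) family** (`{S : G ⊆ S}`), every twist, every ground set `Fin d`. [this work] -/
theorem threePartNT_nonneg_of_containing (τ : Set (Fin d)) (G : Finset (Fin d)) {𝒱 𝒲 : Set (Set (Fin d))} (h𝒱 : IsUpperSet 𝒱) (h𝒲 : IsUpperSet 𝒲) :
    0 ≤ threePartNT τ {S : Set (Fin d) | ∀ a ∈ G, a ∈ S} 𝒱 𝒲 := by
  -- the twisted shadow of the containing family is an orthant
  let p : Pd d := fun a => if a ∈ G then (if a ∈ τ then 1 else 2) else 0
  have hp : ∀ x : Pd d, (∀ a, p a ≤ x a) ↔ {a : Fin d | (a ∉ τ ∧ x a = 2) ∨ (a ∈ τ ∧ x a ≠ 0)} ∈ {S : Set (Fin d) | ∀ a ∈ G, a ∈ S} := by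
    intro x
    simp only [Set.mem_setOf_eq, p]
    constructor
    · intro h a hG
      have ha := h a
      by_cases hτ : a ∈ τ
      · simp only [hG, hτ, if_true] at ha
        exact Or.inr ⟨hτ, fun h0 => by rw [h0] at ha; exact absurd ha (by decide)⟩
      · simp only [hG, hτ, if_true, if_false] at ha
        exact Or.inl ⟨hτ, le_antisymm (Fin.le_last _) ha⟩
    · intro h a
      by_cases hG : a ∈ G
      · rcases h a hG with ⟨hτ, h2⟩ | ⟨hτ, h0⟩
        · simp only [hG, hτ, if_true, if_false, h2]; decide
        · simp only [hG, hτ, if_true]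
          have : x a ≠ 0 := h0
          revert this; generalize x a = u; intro hh; fin_cases u <;> simp_all
      · simp only [hG, if_false]; exact Fin.zero_le _
  have h := sStarD_principal_nonneg d p _ _ (isUpperSet_twistedShadow τ h𝒱) (isUpperSet_twistedShadow τ h𝒲)
  rw [sStarD_twistedShadow_eq τ {S : Set (Fin d) | ∀ a ∈ G, a ∈ S} 𝒱 𝒲 (fun x => by rw [Finset.mem_filter]; simp only [Finset.mem_univ, true_and]; exact hp x)
    (fun x => by simp) (fun x => by simp)] at h
  exact nonneg_of_mul_nonneg_right (by rwa [mul_comm] at h) (by positivity)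

end Summit.CriticalPhenomena.PercolationContinuityZ3.Theorems.SahiGridPattern
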